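import Literature.Analysis.ODE.HalfSpaceFlowTangent
import Mathlib.Analysis.ODE.Gronwall
import HarnessLib

/-!
# Flows in a half-space, tangent case: the wall is invariant

Topic `Literature/Analysis/ODE` (ordinary differential equations serving the manifold-level flow
theory on compact manifolds with boundary, `Literature/Topology/FourManifolds/FlowsBoundaryTangent.lean`
and its companion on the invariance of `∂M`).  `HalfSpaceFlowTangent.lean` shows that the flow
box of a field tangent to the boundary hyperplane `{ℓ = 0}` of the half-space `{ℓ ≥ 0}` keeps
the half-space invariant.  Here: **the wall `{ℓ = 0}` itself is invariant** — solutions starting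
on the wall stay on it — under the linear tangency bound `|ℓ (V x)| ≤ C ℓ(x)` (Grönwall:
`y = ℓ ∘ u ≥ 0` satisfies `|y'| ≤ C y`, `y(0) = 0`), and that bound holds near a wall point for
a field which is Lipschitz within the half-space and tangent to the wall (project onto the wall
along a vector `e` with `ℓ e = 1`).  This is the local content of Lee, *Introduction to Smooth
Manifolds* (2012), Lemma 9.33 / Thm. 9.34 (an integral curve of a field tangent to `∂M` which
starts on `∂M` stays on `∂M`; Lee argues through the integral curves of the restricted field
`V|∂M` and uniqueness — here a Grönwall estimate replaces the restriction to the boundary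
manifold), and of Hirsch, *Differential Topology* (1976), §6.2.

* `abs_apply_le_mul_apply_of_lipschitzOnWith` — the bound `|ℓ (V x)| ≤ (‖ℓ‖ K ‖e‖) ℓ x` on
  `{ℓ ≥ 0} ∩ B(p, R / (1 + ‖ℓ‖‖e‖))` for `V` `K`-Lipschitz on `{ℓ ≥ 0} ∩ B(p, R)` and tangent
  to the wall, `ℓ p = 0`;
* `FlowBox.apply_flow_eq_zero_of_apply_eq_zero` — under the bound, `ℓ x = 0` implies
  `ℓ (flow x t) = 0` for all `t ∈ [-ε, ε]` (Mathlib's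
  `eq_zero_of_abs_deriv_le_mul_abs_self_of_eq_zero_right`, forward and time-reversed).

Everything is proved; no definitions.

## References

* J. M. Lee, *Introduction to Smooth Manifolds*, 2nd ed., GTM 218 (2012), Lemma 9.33,
  Thm. 9.34 (PDF pp. 257–258 of the held copy). [LeeSmoothManifolds2013]
* M. W. Hirsch, *Differential Topology*, GTM 33 (1976), §6.2. [Hirsch1976]
-/

open Set Metric Filter Topology
open scoped NNReal

noncomputable section

namespace Literature.Analysis.ODE

variable {E : Type*} [NormedAddCommGroup E] [NormedSpace ℝ E]

/-! ## The linear tangency bound near a wall point -/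

/-- **A Lipschitz field tangent to the wall satisfies a linear tangency bound near a wall
point.**  Let `V` be `K`-Lipschitz on `{ℓ ≥ 0} ∩ B(p, R)` with `ℓ p = 0`, tangent to the wall
there (`ℓ x = 0 → ℓ (V x) = 0`), and let `e` be a vector with `ℓ e = 1`.  Then
`|ℓ (V x)| ≤ (‖ℓ‖ K ‖e‖) · ℓ x` for `x ∈ {ℓ ≥ 0} ∩ B(p, R / (1 + ‖ℓ‖‖e‖))`: compare `V x` with
`V (x - (ℓ x) e)`, the projection of `x` to the wall along `e`, which stays in `B(p, R)`.
[folklore] -/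
theorem abs_apply_le_mul_apply_of_lipschitzOnWith {ℓ : E →L[ℝ] ℝ} {V : E → E} {p : E} {R : ℝ}
    {K : ℝ≥0} (hK : LipschitzOnWith K V (halfSpace ℓ ∩ ball p R)) (hp : ℓ p = 0) {e : E}
    (he : ℓ e = 1) (htan : ∀ x ∈ halfSpace ℓ ∩ ball p R, ℓ x = 0 → ℓ (V x) = 0) {x : E}
    (hx : x ∈ halfSpace ℓ ∩ ball p (R / (1 + ‖ℓ‖ * ‖e‖))) :
    |ℓ (V x)| ≤ (‖ℓ‖ * K * ‖e‖) * ℓ x := by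
  set R' := R / (1 + ‖ℓ‖ * ‖e‖) with hR'
  have hden : 0 < 1 + ‖ℓ‖ * ‖e‖ := by positivity
  have hxR' : ‖x - p‖ < R' := by rw [← dist_eq_norm]; exact hx.2
  have hR'pos : 0 < R' := lt_of_le_of_lt (norm_nonneg _) hxR'
  have hRpos : 0 < R := by
    have h : R = R' * (1 + ‖ℓ‖ * ‖e‖) := by rw [hR', div_mul_cancel₀ R hden.ne']
    rw [h]; positivity
  have hR'R : R' ≤ R := div_le_self hRpos.le (by nlinarith [norm_nonneg ℓ, norm_nonneg e])
  have hxR : x ∈ halfSpace ℓ ∩ ball p R := ⟨hx.1, ball_subset_ball hR'R hx.2⟩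
  have hx0 : 0 ≤ ℓ x := mem_halfSpace.1 hx.1
  -- the projection to the wall along `e`
  set π : E := x - (ℓ x) • e with hπ
  have hπ0 : ℓ π = 0 := by simp [hπ, he]
  have hℓx : |ℓ x| ≤ ‖ℓ‖ * ‖x - p‖ := by
    have h := ℓ.le_opNorm (x - p)
    rwa [map_sub, hp, sub_zero, Real.norm_eq_abs] at h
  have hπp : π ∈ halfSpace ℓ ∩ ball p R := by
    refine ⟨mem_halfSpace.2 hπ0.symm.le, ?_⟩
    rw [mem_ball, dist_eq_norm]
    calc ‖π - p‖ = ‖(x - p) - (ℓ x) • e‖ := by rw [hπ]; abel_nf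
      _ ≤ ‖x - p‖ + ‖(ℓ x) • e‖ := norm_sub_le _ _
      _ = ‖x - p‖ + |ℓ x| * ‖e‖ := by rw [norm_smul, Real.norm_eq_abs]
      _ ≤ ‖x - p‖ + ‖ℓ‖ * ‖x - p‖ * ‖e‖ := by
          gcongr
      _ = ‖x - p‖ * (1 + ‖ℓ‖ * ‖e‖) := by ring
      _ < R' * (1 + ‖ℓ‖ * ‖e‖) := by gcongr
      _ = R := by rw [hR', div_mul_cancel₀ R hden.ne']
  have hVπ : ℓ (V π) = 0 := htan π hπp hπ0
  have hdist : ‖V x - V π‖ ≤ K * ‖x - π‖ := by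
    rw [← dist_eq_norm, ← dist_eq_norm]; exact hK.dist_le_mul x hxR π hπp
  have hxπ : ‖x - π‖ = ℓ x * ‖e‖ := by
    have h : x - π = (ℓ x) • e := by rw [hπ]; abel
    rw [h, norm_smul, Real.norm_eq_abs, abs_of_nonneg hx0]
  calc |ℓ (V x)| = |ℓ (V x - V π)| := by rw [map_sub, hVπ, sub_zero]
    _ ≤ ‖ℓ‖ * ‖V x - V π‖ := by
        have h := ℓ.le_opNorm (V x - V π); rwa [Real.norm_eq_abs] at h
    _ ≤ ‖ℓ‖ * (K * ‖x - π‖) := by gcongr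
    _ = (‖ℓ‖ * K * ‖e‖) * ℓ x := by rw [hxπ]; ring

/-- The tangency bound `|ℓ (V x)| ≤ C ℓ(x)` implies tangency to the wall. [folklore] -/
theorem tangent_of_abs_apply_le {ℓ : E →L[ℝ] ℝ} {V : E → E} {p : E} {R C : ℝ}
    (hC : ∀ x ∈ halfSpace ℓ ∩ ball p R, |ℓ (V x)| ≤ C * ℓ x) :
    ∀ x ∈ halfSpace ℓ ∩ ball p R, ℓ x = 0 → ℓ (V x) = 0 := by
  intro x hx h0
  have h := hC x hx
  rw [h0, mul_zero] at h
  exact abs_nonpos_iff.1 h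

/-! ## Flow boxes under the tangency bound: the wall is invariant -/

namespace FlowBox

variable {ℓ : E →L[ℝ] ℝ} {pr : E → E} {V : E → E} {p : E} {R : ℝ} (B : FlowBox pr V p R)
  (hpr : IsHalfSpaceRetraction ℓ pr) (hp : p ∈ halfSpace ℓ)
  {C : ℝ} (hC : ∀ x ∈ halfSpace ℓ ∩ ball p R, |ℓ (V x)| ≤ C * ℓ x)
include hpr hp hC

/-- Along solutions starting in the half-space, `y = ℓ ∘ u` solves `y' = ℓ (V u)` within
`[-ε, ε]`, with `|ℓ (V u)| ≤ C |y|`. [folklore] -/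
theorem hasDerivWithinAt_apply_flow_of_bound {x : E} (hx : x ∈ halfSpace ℓ ∩ closedBall p B.r)
    {t : ℝ} (ht : t ∈ Icc (-B.ε) B.ε) :
    HasDerivWithinAt (fun s => ℓ (B.flow x s)) (ℓ (V (B.flow x t))) (Icc (-B.ε) B.ε) t ∧
      |ℓ (V (B.flow x t))| ≤ C * |ℓ (B.flow x t)| := by
  have htan := tangent_of_abs_apply_le hC
  have hmem := B.flow_mem_of_tangent hpr hp htan hx ht
  refine ⟨?_, ?_⟩
  · have h := B.hasDerivWithinAt_apply_flow (ℓ := ℓ) hx.2 ht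
    rwa [hpr.eq_self _ hmem.1] at h
  · rw [abs_of_nonneg (mem_halfSpace.1 hmem.1)]
    exact hC _ hmem

/-- **The wall is invariant** (Lee 2012, Lemma 9.33 / Thm. 9.34, local form; Hirsch 1976,
§6.2): under the tangency bound `|ℓ (V x)| ≤ C ℓ(x)` on `{ℓ ≥ 0} ∩ B(p, R)`, a solution of the
flow box starting at a point `x` of the wall (`ℓ x = 0`) stays on the wall for all
`t ∈ [-ε, ε]`: `y(t) = ℓ (flow x t) ≥ 0` has `y(0) = 0` and `|y'| ≤ C |y|`, so `y ≡ 0` by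
Grönwall, forward in time and, after time reversal, backward.
[cite: LeeSmoothManifolds2013, Lemma 9.33 and Thm. 9.34] -/
theorem apply_flow_eq_zero_of_apply_eq_zero {x : E} (hx : x ∈ halfSpace ℓ ∩ closedBall p B.r)
    (hx0 : ℓ x = 0) {t : ℝ} (ht : t ∈ Icc (-B.ε) B.ε) : ℓ (B.flow x t) = 0 := by
  set y : ℝ → ℝ := fun s => ℓ (B.flow x s) with hy
  have hyc : ContinuousOn y (Icc (-B.ε) B.ε) :=
    ℓ.continuous.comp_continuousOn (B.continuousOn_flow hx.2)
  have hy0 : y 0 = 0 := by simp only [hy, B.flow_zero x hx.2]; exact hx0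
  have hd := fun s (hs : s ∈ Icc (-B.ε) B.ε) => B.hasDerivWithinAt_apply_flow_of_bound hpr hp hC hx hs
  rcases le_total 0 t with h0t | ht0
  · -- forward, on `[0, ε]`
    have hsub : Icc 0 B.ε ⊆ Icc (-B.ε) B.ε := Icc_subset_Icc (by linarith [B.ε_pos]) le_rfl
    have h := eq_zero_of_abs_deriv_le_mul_abs_self_of_eq_zero_right (f := y)
      (f' := fun s => ℓ (V (B.flow x s))) (K := C) (a := 0) (b := B.ε) (hyc.mono hsub)
      (fun s hs => ?_) hy0 (fun s hs => ?_) t ⟨h0t, ht.2⟩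
    · exact h
    · exact (hd s (hsub (Ico_subset_Icc_self hs))).1.mono_of_mem_nhdsWithin
        (mem_of_superset (Icc_mem_nhdsGE hs.2) (Icc_subset_Icc (by linarith [hs.1, B.ε_pos]) le_rfl))
    · rw [Real.norm_eq_abs, Real.norm_eq_abs]
      exact (hd s (hsub (Ico_subset_Icc_self hs))).2
  · -- backward: `z s = y (-s)` on `[0, ε]`
    set z : ℝ → ℝ := fun s => y (-s) with hz
    have hmaps : MapsTo (fun s : ℝ => -s) (Icc (-B.ε) B.ε) (Icc (-B.ε) B.ε) := fun s hs =>
      ⟨by linarith [hs.2], by linarith [hs.1]⟩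
    have hsub : Icc 0 B.ε ⊆ Icc (-B.ε) B.ε := Icc_subset_Icc (by linarith [B.ε_pos]) le_rfl
    have hzc : ContinuousOn z (Icc 0 B.ε) := (hyc.comp continuousOn_neg hmaps).mono hsub
    have hz0 : z 0 = 0 := by simp only [hz, neg_zero]; exact hy0
    have h := eq_zero_of_abs_deriv_le_mul_abs_self_of_eq_zero_right (f := z)
      (f' := fun s => ℓ (V (B.flow x (-s))) * (-1)) (K := C) (a := 0) (b := B.ε) hzc
      (fun s hs => ?_) hz0 (fun s hs => ?_) (-t) ⟨by linarith, by linarith [ht.1]⟩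
    · simpa [hz, hy] using h
    · have hs' : -s ∈ Icc (-B.ε) B.ε := ⟨by linarith [hs.2], by linarith [hs.1, B.ε_pos]⟩
      have h1 := ((hd (-s) hs').1.comp s (hasDerivWithinAt_neg s (Icc (-B.ε) B.ε)) hmaps)
      exact h1.mono_of_mem_nhdsWithin
        (mem_of_superset (Icc_mem_nhdsGE hs.2) (Icc_subset_Icc (by linarith [hs.1, B.ε_pos]) le_rfl))
    · have hs' : -s ∈ Icc (-B.ε) B.ε := ⟨by linarith [hs.2], by linarith [hs.1, B.ε_pos]⟩
      rw [Real.norm_eq_abs, Real.norm_eq_abs, mul_neg_one, abs_neg]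
      exact (hd (-s) hs').2

/-- The wall invariance in membership form: solutions from wall points of the ball of initial
conditions stay in `{ℓ = 0} ∩ B(p, R)`. [cite: LeeSmoothManifolds2013, Lemma 9.33 and Thm. 9.34] -/
theorem flow_mem_wall_of_apply_eq_zero {x : E} (hx : x ∈ halfSpace ℓ ∩ closedBall p B.r)
    (hx0 : ℓ x = 0) {t : ℝ} (ht : t ∈ Icc (-B.ε) B.ε) :
    B.flow x t ∈ halfSpace ℓ ∩ ball p R ∧ ℓ (B.flow x t) = 0 :=
  ⟨B.flow_mem_of_tangent hpr hp (tangent_of_abs_apply_le hC) hx ht,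
    B.apply_flow_eq_zero_of_apply_eq_zero hpr hp hC hx hx0 ht⟩

end FlowBox

end Literature.Analysis.ODE

end
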